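import Literature.NumberTheory.Automorphic.ArchStableOrbitalSumRepresentatives   -- ★ (V8)-orb (p839067): (r1), (r1-arch), (r2′), (r2), fibre counting
import Literature.NumberTheory.Automorphic.ArchTorusOrbitalFunction             -- ★ (V2′) (p837696, p06): fixed-quotient torus term, `orbitalIntegral_archDiagTorus_eq_integral_descConj`, torus hygiene
import Literature.MeasureTheory.Group.InvariantQuotientCompactSubgroup           -- ★ D1′c (1) (p836364, p08): `integral_quotientMeasure_eq_inv_smul` (compact subgroup)
import HarnessLib

/-!
# The (V2′)↔(V8)-orb JUNCTION on `G′_∞ = U(diag α)(L⁺ ⊗ ℝ)`: at a compact centraliser the canonical class orbital integral is the plain group integral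
# `∫_G a(g γ g⁻¹) dν`, hence `Φ(⟦t z⟧, a)` = the fixed-quotient torus term with the probability torus measure, and `Φ^st_∞(t z, a)` is an explicit average of group integrals
(Rogawski 1990 §4.9 p. 54, §8.2 Prop. 8.2.1 p. 118; Folland (2.52))

Topic `NumberTheory/Automorphic`; namespaces `Literature.NumberTheory.Automorphic` (§1, generic) and `….UnitaryGroup` (§§2–3).  THEOREMS ONLY (no definition, no instance, no
notation, no named fact, no `sorry`).  Cell `pub/hodgecm-mathlib`, ENGINE T1 (crux H413 = `stmt-HodgeConjecture-24833`); floor-1 preparation, count-neutral, under books rows #88 (ST-∞)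
∕ #111 (S-d): road D2′, brick **«(V2′)↔(V8)-orb JUNCTION»** (LEAD WORD T7-63, F0P3a-plan (g8), 2026-09-01; author F0P3a-p02 (g9)), GLOBAL half; the per-place half is the sequel
`ArchLocalStableOrbitalSumTorus`.  Joins ★ (V8)-orb `ArchStableOrbitalSumRepresentatives` (p839067, F0P3a-p02: `Φ(⟦t z⟧, a) = orbitalIntegral (t z) a (ν ∕ t_prob)`, `Φ^st_∞ = K⁻¹ Σ_ρ`)
with ★ (V2′) `ArchTorusOrbitalFunction` (p837696, F0P3a-p06: the fixed-quotient torus term `F_a(z) = ∫_{G′_∞∕T_∞} descConj (t z) T_∞ a d(ν∕t_T)`) through ★ D1′c (1)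
`integral_quotientMeasure_eq_inv_smul` (p836364, F0P3a-p08: by a COMPACT subgroup `μ_{G∕H} = t(H)⁻¹ • π_*ν`): with `t` a PROBABILITY Haar measure every quotient disappears.

WHAT IS PROVED.
* §1 (generic locally compact second countable T₂ `G`; `a` continuous): **`orbitalIntegral_quotientMeasure_eq_integral_conj_of_isCompact`** — `Z(γ)` compact, `t` a Haar probability
  measure on it ⇒ `orbitalIntegral γ a (ν ∕ t) = ∫_G a(g γ g⁻¹) dν(g)`; **`OrbitalMeasureFamily.IsCanonical.classOrbitalIntegral_mk_eq_integral_conj_of_isCompact`** — `m` canonical for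
  `(P, ν)`, `P (out ⟦γ⟧)`, `Z(γ)` compact ⇒ `classOrbitalIntegral m a ⟦γ⟧ = ∫_G a(g γ g⁻¹) dν(g)` (★ (V8)-orb (r1) + the former).
* §2 (`G′_∞`, `H = diag α`, `α_i ≠ 0`, `c α_i = α_i`, regular `z`; `m` canonical on the regular classes for the Haar measure `ν`): `integral_descConj_archDiagTorus_eq_integral_conj` (the ★
  (V2′) torus term with the PROBABILITY `t_T` is `∫_{G′_∞} a(g t(z) g⁻¹) dν` at EVERY `z`), **(j1) `classOrbitalIntegral_mk_archDiagTorus_eq_integral_conj`** and **(j1′)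
  `…_eq_integral_descConj`** (`Φ(⟦t z⟧, a) = ∫ a(g t(z) g⁻¹) dν = F_a(z)`: (V8)-orb and (V2′) are ONE function of `z`), **(j2) `archStableOrbitalIntegral_archDiagTorus_eq_inv_mul_sum_integral_conj`**
  (`Φ^st_∞(t z, a) = (Π_w p_w!(N−p_w)!)⁻¹ · Σ_{ρ ∈ Π_w S_N} ∫ a(g t(z∘ρ) g⁻¹) dν` — at a `(2,1)` place `½ Σ_{σ ∈ S₃}`) and **(j2-rep) `…_eq_sum_integral_conj_of_transversal`** (print's
  `Σ_{γ′ ∈ {γ,γ₁,γ₂}} Φ(γ′, f)`, quotient-free).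
* §3 **(j3) `continuousOn_archStableOrbitalIntegral_archDiagTorus_of_continuousOn`** — continuity of `z ↦ Φ^st_∞(t z, a)` on `T_reg = {z ∣ ∀ w, z_w injective}` FROM the continuity of the
  torus function `z ↦ ∫ a(g t(z) g⁻¹) dν` there (hypothesis `hF`: the GLOBAL (V2)-glob statement of ROAD-Sd is F0P3a-p06's pending sequel `ArchTorusOrbitalContinuity`; per place it is his
  (a5) `continuousOn_integral_comp_conj_circleDiagonal` — the per-place twin of (j3) in the sequel consumes that head by name).
CONSUMERS AT FLOOR 2: (L-use)∕(L-st)∕(L-cont) read (j2)∕(j3) (the `K⁻¹ Σ_ρ ∫` shape differentiates termwise along ★ `ArchTorusOneAngleCurve`); (ST-∞) compares (j2) on the two inner forms.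
JUNK AUDIT: `IsCompact Z(γ)` is necessary in §1 (for a non-compact centraliser `ν ∕ t` is not `π_*ν` up to a scalar); `[IsProbabilityMeasure t]` pins the scalar to `1` (for a general Haar
`t` the right-hand side carries `t(Z(γ))⁻¹`, ★ (V2)-Q `integral_descConj_circleDiagonal_eq_inv_smul`); `hz` as in (V8)-orb.  HONEST LABEL: HC_CM is proved only modulo the printed citations
until rung 0 closes; this file is measure-theoretic book-keeping (count-neutral floor-1 preparation) and pays nothing by itself.

## References
* [Rogawski1990] J. D. Rogawski, *Automorphic Representations of Unitary Groups in Three Variables*, Ann. of Math. Stud. 123 (1990): §1.7 p. 6, §4.1 (4.1.1) p. 39, §4.9 p. 54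
  (`Φ(γ, f) = ∫_{G_γ∖G} f(g⁻¹γg) dg`), §8.2 Prop. 8.2.1 p. 118 (`γ, γ₁, γ₂`; `Φ_H(γ, f^H)` as a function on the compact Cartan).
* [Folland1995] G. B. Folland, *A Course in Abstract Harmonic Analysis* (1995), §2.6 Thm. 2.49 and (2.52) (quotient by a compact subgroup).
* [DeitmarEchterhoff2014] A. Deitmar, S. Echterhoff, *Principles of Harmonic Analysis*, 2nd ed. (2014), Thm. 1.5.3, Cor. 1.5.4.
* [Shelstad1979] D. Shelstad, *Characters and inner forms of a quasi-split group over ℝ*, Compositio Math. 39 (1979), §4 (orbital integrals on `T_reg`).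
* [BrockerTomDieck1985] Th. Bröcker, T. tom Dieck, *Representations of Compact Lie Groups*, GTM 98 (1985), Ch. IV (3.1).
-/

set_option autoImplicit false

noncomputable section

open MeasureTheory Measure Set Matrix Equiv NumberField NumberField.InfinitePlace NumberField.mixedEmbedding TopologicalSpace Literature.MeasureTheory.Group
open scoped MatrixGroups ENNReal NNReal

namespace Literature.NumberTheory.Automorphic

/-! ## §1 Generic: at a COMPACT centraliser the orbital integral against `dν ∕ dt_prob` is the plain group integral `∫_G a(g γ g⁻¹) dν(g)` -/

section CompactCentralizer

variable {G : Type*} [Group G] [TopologicalSpace G] [IsTopologicalGroup G] [LocallyCompactSpace G]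
  [SecondCountableTopology G] [T2Space G] [MeasurableSpace G] [BorelSpace G]
  [∀ γ : G, MeasurableSpace (G ⧸ Subgroup.centralizer ({γ} : Set G))]
  [∀ γ : G, BorelSpace (G ⧸ Subgroup.centralizer ({γ} : Set G))]

/-- **`O_γ(a; dν ∕ dt) = ∫_G a(g γ g⁻¹) dν(g)` for a COMPACT centraliser `Z(γ)` and a PROBABILITY Haar measure `t` on it** (`a` continuous): the invariant quotient measure by a
compact subgroup is `t(Z(γ))⁻¹ • π_* ν` (★ `integral_quotientMeasure_eq_inv_smul`, Folland (2.52)), and `t(Z(γ)) = 1`.  No regularity, no compactness of `G`.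
[cite: Folland1995, §2.6 (2.52)] [cite: Rogawski1990, §4.9 p. 54; §1.7 p. 6] -/
theorem orbitalIntegral_quotientMeasure_eq_integral_conj_of_isCompact (γ : G)
    (hZ : IsCompact ((Subgroup.centralizer ({γ} : Set G) : Subgroup G) : Set G))
    (t : Measure (Subgroup.centralizer ({γ} : Set G))) [t.IsHaarMeasure] [t.IsInvInvariant] [IsProbabilityMeasure t]
    (ν : Measure G) [ν.IsHaarMeasure] [ν.IsMulRightInvariant] {E : Type*} [NormedAddCommGroup E] [NormedSpace ℝ E]
    (a : G → E) (ha : Continuous a) :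
    orbitalIntegral γ a (quotientMeasure (Subgroup.centralizer ({γ} : Set G)) t (isClosed_coe_centralizer_singleton γ) ν) =
      ∫ g, a (g * γ * g⁻¹) ∂ν := by
  haveI : CompactSpace (Subgroup.centralizer ({γ} : Set G)) := isCompact_iff_compactSpace.mp hZ
  haveI : IsClosed ((Subgroup.centralizer ({γ} : Set G) : Subgroup G) : Set G) := isClosed_coe_centralizer_singleton γ
  rw [orbitalIntegral_eq_integral_descConj,
    integral_quotientMeasure_eq_inv_smul _ t ν _ (continuous_descConj _ _ _ ha).stronglyMeasurable]
  simp only [descConj_mk, probReal_univ, inv_one, one_smul]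

/-- **A CANONICAL FAMILY AT A CLASS WITH COMPACT CENTRALISER IS THE PLAIN GROUP INTEGRAL**: `m` canonical for `(P, ν)`, `P (out ⟦γ⟧)`, `Z(γ)` compact, `a` continuous ⇒
`classOrbitalIntegral m a ⟦γ⟧ = ∫_G a(g γ g⁻¹) dν(g)` (★ (V8)-orb (r1) with the probability Haar measure of ★ `exists_isHaarMeasure_isProbabilityMeasure_of_isCompact`, then §1).
The measure-free right-hand side is what makes «`Φ(γ, f)` as a function of `γ ∈ T_reg`» honest. [cite: Rogawski1990, §4.9 p. 54; §8.2 Prop. 8.2.1 p. 118] [cite: Folland1995, §2.6 (2.52)] -/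
theorem OrbitalMeasureFamily.IsCanonical.classOrbitalIntegral_mk_eq_integral_conj_of_isCompact {P : G → Prop} {ν : Measure G}
    [ν.IsHaarMeasure] [ν.IsMulRightInvariant] {m : OrbitalMeasureFamily G} (hm : m.IsCanonical P ν) (γ : G)
    (hc : P (Quotient.out (ConjClasses.mk γ))) (hZ : IsCompact ((Subgroup.centralizer ({γ} : Set G) : Subgroup G) : Set G))
    (a : G → ℂ) (ha : Continuous a) :
    classOrbitalIntegral m a (ConjClasses.mk γ) = ∫ g, a (g * γ * g⁻¹) ∂ν := by
  obtain ⟨t, ht, hti, htp⟩ := exists_isHaarMeasure_isProbabilityMeasure_of_isCompact γ hZ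
  rw [hm.classOrbitalIntegral_mk_eq_orbitalIntegral_of_isCompact γ hc hZ t a,
    orbitalIntegral_quotientMeasure_eq_integral_conj_of_isCompact γ hZ t ν a ha]

end CompactCentralizer

namespace UnitaryGroup

open Literature.LinearAlgebra.Matrix Literature.NumberTheory.Rogawski1990

/-! ## §2 GLOBAL `G′_∞ = U(diag α)(L⁺ ⊗ ℝ)`: the torus term of ★ (V2′) with the PROBABILITY torus measure, and `Φ^st_∞` as an explicit average of group integrals -/

section Torus

variable (L : Type) [Field L] [NumberField L] [IsCMField L] (N : ℕ) (α : Fin N → L)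
  [MeasurableSpace (arch (↥(maximalRealSubfield L)) L (IsCMField.complexConj L) N (diagonal α))]
  [BorelSpace (arch (↥(maximalRealSubfield L)) L (IsCMField.complexConj L) N (diagonal α))]

/-- **THE (V2′) FIXED-QUOTIENT TORUS TERM WITH THE PROBABILITY TORUS MEASURE IS THE PLAIN GROUP INTEGRAL** — at EVERY `z` (singular included):
`∫_{G′_∞ ∕ T_∞} descConj (t z) T_∞ a d(ν ∕ t_T) = ∫_{G′_∞} a(g · t(z) · g⁻¹) dν(g)` for `t_T` the Haar probability measure of the compact torus `T_∞ = range t` and continuous `a`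
(global twin of ★ (V2)-Q `integral_descConj_circleDiagonal_eq_inv_smul` at mass one). [cite: Rogawski1990, §8.2 Prop. 8.2.1 p. 118; §4.9 p. 54] [cite: Folland1995, §2.6 (2.52)] -/
theorem integral_descConj_archDiagTorus_eq_integral_conj
    (ν : Measure (arch (↥(maximalRealSubfield L)) L (IsCMField.complexConj L) N (diagonal α))) [ν.IsHaarMeasure] [ν.IsMulRightInvariant]
    (tT : Measure (archDiagTorus L N α).range) [tT.IsHaarMeasure] [tT.IsInvInvariant] [IsProbabilityMeasure tT]
    [MeasurableSpace (arch (↥(maximalRealSubfield L)) L (IsCMField.complexConj L) N (diagonal α) ⧸ (archDiagTorus L N α).range)]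
    [BorelSpace (arch (↥(maximalRealSubfield L)) L (IsCMField.complexConj L) N (diagonal α) ⧸ (archDiagTorus L N α).range)]
    {E : Type*} [NormedAddCommGroup E] [NormedSpace ℝ E]
    (z : {w : InfinitePlace L // IsComplex w} → Fin N → Circle) (a : arch (↥(maximalRealSubfield L)) L (IsCMField.complexConj L) N (diagonal α) → E)
    (ha : Continuous a) :
    ∫ y, descConj (archDiagTorus L N α z) (archDiagTorus L N α).range (range_archDiagTorus_comm_apply L N α z) a y
        ∂(quotientMeasure _ tT (isClosed_coe_range_archDiagTorus L N α) ν) =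
      ∫ g, a (g * archDiagTorus L N α z * g⁻¹) ∂ν := by
  haveI : CompactSpace (archDiagTorus L N α).range := isCompact_iff_compactSpace.mp (isCompact_coe_range_archDiagTorus L N α)
  haveI : IsClosed (((archDiagTorus L N α).range : Subgroup (arch (↥(maximalRealSubfield L)) L (IsCMField.complexConj L) N (diagonal α))) :
      Set (arch (↥(maximalRealSubfield L)) L (IsCMField.complexConj L) N (diagonal α))) := isClosed_coe_range_archDiagTorus L N α
  rw [integral_quotientMeasure_eq_inv_smul _ tT ν _ (continuous_descConj _ _ _ ha).stronglyMeasurable]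
  simp only [descConj_mk, probReal_univ, inv_one, one_smul]

variable [∀ g : ↥(arch (↥(maximalRealSubfield L)) L (IsCMField.complexConj L) N (diagonal α)),
    MeasurableSpace (↥(arch (↥(maximalRealSubfield L)) L (IsCMField.complexConj L) N (diagonal α)) ⧸
      Subgroup.centralizer ({g} : Set ↥(arch (↥(maximalRealSubfield L)) L (IsCMField.complexConj L) N (diagonal α))))]
  [∀ g : ↥(arch (↥(maximalRealSubfield L)) L (IsCMField.complexConj L) N (diagonal α)),
    BorelSpace (↥(arch (↥(maximalRealSubfield L)) L (IsCMField.complexConj L) N (diagonal α)) ⧸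
      Subgroup.centralizer ({g} : Set ↥(arch (↥(maximalRealSubfield L)) L (IsCMField.complexConj L) N (diagonal α))))]

/-- **(j1) `Φ(⟦t(z)⟧, a) = ∫_{G′_∞} a(g · t(z) · g⁻¹) dν(g)` AT A REGULAR TORUS CLASS** for a family `m` canonical on the regular classes for the Haar measure `ν` of `G′_∞` and continuous
`a` — hence (previous theorem) `= ` the ★ (V2′) fixed-quotient torus term `F_a(z)` with the probability torus measure: (V8)-orb and (V2′) speak about ONE function of `z`.
[cite: Rogawski1990, §4.9 p. 54; §8.2 Prop. 8.2.1 p. 118] [cite: Folland1995, §2.6 (2.52)] -/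
theorem classOrbitalIntegral_mk_archDiagTorus_eq_integral_conj (hα : ∀ i, α i ≠ 0)
    {ν : Measure (arch (↥(maximalRealSubfield L)) L (IsCMField.complexConj L) N (diagonal α))} [ν.IsHaarMeasure] [ν.IsMulRightInvariant]
    {m : OrbitalMeasureFamily ↥(arch (↥(maximalRealSubfield L)) L (IsCMField.complexConj L) N (diagonal α))}
    (hm : m.IsCanonical (fun γ => IsRegularElt (γ.val : GL (Fin N) (mixedSpace L))) ν)
    {z : {w : InfinitePlace L // IsComplex w} → Fin N → Circle} (hz : ∀ w, Function.Injective (z w))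
    (a : arch (↥(maximalRealSubfield L)) L (IsCMField.complexConj L) N (diagonal α) → ℂ) (ha : Continuous a) :
    classOrbitalIntegral m a (ConjClasses.mk (archDiagTorus L N α z)) = ∫ g, a (g * archDiagTorus L N α z * g⁻¹) ∂ν :=
  hm.classOrbitalIntegral_mk_eq_integral_conj_of_isCompact _ (isRegularElt_out_mk_archDiagTorus L N α hz)
    (isCompact_centralizer_archDiagTorus L N α hα hz) a ha

/-- **(j1′) … and `= F_a(z)`**, the ★ (V2′) fixed-quotient torus term with the probability torus measure `t_T` (same `z`, same `a`).
[cite: Rogawski1990, §4.9 p. 54; §8.2 Prop. 8.2.1 p. 118] [cite: DeitmarEchterhoff2014, Thm. 1.5.3] -/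
theorem classOrbitalIntegral_mk_archDiagTorus_eq_integral_descConj (hα : ∀ i, α i ≠ 0)
    {ν : Measure (arch (↥(maximalRealSubfield L)) L (IsCMField.complexConj L) N (diagonal α))} [ν.IsHaarMeasure] [ν.IsMulRightInvariant]
    {m : OrbitalMeasureFamily ↥(arch (↥(maximalRealSubfield L)) L (IsCMField.complexConj L) N (diagonal α))}
    (hm : m.IsCanonical (fun γ => IsRegularElt (γ.val : GL (Fin N) (mixedSpace L))) ν)
    (tT : Measure (archDiagTorus L N α).range) [tT.IsHaarMeasure] [tT.IsInvInvariant] [IsProbabilityMeasure tT]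
    [MeasurableSpace (arch (↥(maximalRealSubfield L)) L (IsCMField.complexConj L) N (diagonal α) ⧸ (archDiagTorus L N α).range)]
    [BorelSpace (arch (↥(maximalRealSubfield L)) L (IsCMField.complexConj L) N (diagonal α) ⧸ (archDiagTorus L N α).range)]
    {z : {w : InfinitePlace L // IsComplex w} → Fin N → Circle} (hz : ∀ w, Function.Injective (z w))
    (a : arch (↥(maximalRealSubfield L)) L (IsCMField.complexConj L) N (diagonal α) → ℂ) (ha : Continuous a) :
    classOrbitalIntegral m a (ConjClasses.mk (archDiagTorus L N α z)) =
      ∫ y, descConj (archDiagTorus L N α z) (archDiagTorus L N α).range (range_archDiagTorus_comm_apply L N α z) a y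
        ∂(quotientMeasure _ tT (isClosed_coe_range_archDiagTorus L N α) ν) := by
  rw [classOrbitalIntegral_mk_archDiagTorus_eq_integral_conj L N α hα hm hz a ha, integral_descConj_archDiagTorus_eq_integral_conj L N α ν tT z a ha]

open scoped Classical in
/-- **(j2) `Φ^st_∞(t(z), a) = (Π_w p_w!(N−p_w)!)⁻¹ · Σ_{ρ ∈ Π_w S_N} ∫_{G′_∞} a(g · t(z∘ρ) · g⁻¹) dν(g)`** — the archimedean stable orbital integral of LETTER #4 at a regular torus point as an
EXPLICIT, measure-free, `ρ`-symmetric average of group integrals (canonical `m` for `ν`, continuous `a`; ★ (V8)-orb (r2′) + (j1)).  At a place of signature `(2,1)`: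
`Φ^st = ½ Σ_{σ ∈ S₃} ∫ a(g t(z∘σ) g⁻¹) dν`. [cite: Rogawski1990, §4.1 (4.1.1) p. 39; §8.2 Prop. 8.2.1 p. 118; §4.9 p. 54] [cite: Folland1995, §2.6 (2.52)] -/
theorem archStableOrbitalIntegral_archDiagTorus_eq_inv_mul_sum_integral_conj (hα : ∀ i, α i ≠ 0)
    (hherm : ∀ i, (IsCMField.complexConj L (α i) : L) = α i)
    {ν : Measure (arch (↥(maximalRealSubfield L)) L (IsCMField.complexConj L) N (diagonal α))} [ν.IsHaarMeasure] [ν.IsMulRightInvariant]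
    {m : OrbitalMeasureFamily ↥(arch (↥(maximalRealSubfield L)) L (IsCMField.complexConj L) N (diagonal α))}
    (hm : m.IsCanonical (fun γ => IsRegularElt (γ.val : GL (Fin N) (mixedSpace L))) ν)
    {z : {w : InfinitePlace L // IsComplex w} → Fin N → Circle} (hz : ∀ w, Function.Injective (z w))
    (a : arch (↥(maximalRealSubfield L)) L (IsCMField.complexConj L) N (diagonal α) → ℂ) (ha : Continuous a) :
    archStableOrbitalIntegral L N (diagonal α) m a (archDiagTorus L N α z) =
      ((∏ w : {w : InfinitePlace L // IsComplex w},
          (Finset.univ.filter fun i => 0 < (w.1.embedding (α i)).re).card.factorial *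
            (N - (Finset.univ.filter fun i => 0 < (w.1.embedding (α i)).re).card).factorial : ℕ) : ℂ)⁻¹ *
        ∑ ρ : {w : InfinitePlace L // IsComplex w} → Perm (Fin N), ∫ g, a (g * archDiagTorus L N α (fun w => z w ∘ ρ w) * g⁻¹) ∂ν := by
  rw [archStableOrbitalIntegral_archDiagTorus_eq_inv_mul_sum_classOrbitalIntegral L N α hα hherm hz m a]
  congr 1
  exact Finset.sum_congr rfl fun ρ _ =>
    classOrbitalIntegral_mk_archDiagTorus_eq_integral_conj L N α hα hm (fun w => (hz w).comp (ρ w).injective) a ha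

open scoped Classical in
/-- **(j2-rep) `Φ^st_∞(t(z), a) = Σ_{ρ ∈ S} ∫_{G′_∞} a(g · t(z∘ρ) · g⁻¹) dν(g)` over ANY transversal `S`** of the sign-pattern cosets (print's `Σ_{γ′ ∈ {γ, γ₁, γ₂}} Φ(γ′, f)` with compatible
measures, the quotient-free form). [cite: Rogawski1990, §4.1 (4.1.1) p. 39; §8.2 Prop. 8.2.1 p. 118] [cite: Folland1995, §2.6 (2.52)] -/
theorem archStableOrbitalIntegral_archDiagTorus_eq_sum_integral_conj_of_transversal (hα : ∀ i, α i ≠ 0)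
    (hherm : ∀ i, (IsCMField.complexConj L (α i) : L) = α i)
    {ν : Measure (arch (↥(maximalRealSubfield L)) L (IsCMField.complexConj L) N (diagonal α))} [ν.IsHaarMeasure] [ν.IsMulRightInvariant]
    {m : OrbitalMeasureFamily ↥(arch (↥(maximalRealSubfield L)) L (IsCMField.complexConj L) N (diagonal α))}
    (hm : m.IsCanonical (fun γ => IsRegularElt (γ.val : GL (Fin N) (mixedSpace L))) ν)
    {z : {w : InfinitePlace L // IsComplex w} → Fin N → Circle} (hz : ∀ w, Function.Injective (z w))
    (a : arch (↥(maximalRealSubfield L)) L (IsCMField.complexConj L) N (diagonal α) → ℂ) (ha : Continuous a)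
    (S : Finset ({w : InfinitePlace L // IsComplex w} → Perm (Fin N)))
    (hinj : Set.InjOn (fun ρ : {w : InfinitePlace L // IsComplex w} → Perm (Fin N) => ConjClasses.mk (archDiagTorus L N α fun w => z w ∘ ρ w)) ↑S)
    (himg : S.image (fun ρ : {w : InfinitePlace L // IsComplex w} → Perm (Fin N) => ConjClasses.mk (archDiagTorus L N α fun w => z w ∘ ρ w)) =
      Finset.univ.image fun ρ : {w : InfinitePlace L // IsComplex w} → Perm (Fin N) => ConjClasses.mk (archDiagTorus L N α fun w => z w ∘ ρ w)) :
    archStableOrbitalIntegral L N (diagonal α) m a (archDiagTorus L N α z) =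
      ∑ ρ ∈ S, ∫ g, a (g * archDiagTorus L N α (fun w => z w ∘ ρ w) * g⁻¹) ∂ν := by
  rw [archStableOrbitalIntegral_archDiagTorus_eq_sum_classOrbitalIntegral_of_transversal L N α hα hherm hz m a S hinj himg]
  exact Finset.sum_congr rfl fun ρ _ =>
    classOrbitalIntegral_mk_archDiagTorus_eq_integral_conj L N α hα hm (fun w => (hz w).comp (ρ w).injective) a ha

/-! ## §3 Continuity of `z ↦ Φ^st_∞(t(z), a)` on the regular set FROM the continuity of the torus function (the latter is ROAD-Sd (V2)-glob, p06) -/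

omit [MeasurableSpace (arch (↥(maximalRealSubfield L)) L (IsCMField.complexConj L) N (diagonal α))]
  [BorelSpace (arch (↥(maximalRealSubfield L)) L (IsCMField.complexConj L) N (diagonal α))]
  [∀ g : ↥(arch (↥(maximalRealSubfield L)) L (IsCMField.complexConj L) N (diagonal α)),
    MeasurableSpace (↥(arch (↥(maximalRealSubfield L)) L (IsCMField.complexConj L) N (diagonal α)) ⧸
      Subgroup.centralizer ({g} : Set ↥(arch (↥(maximalRealSubfield L)) L (IsCMField.complexConj L) N (diagonal α))))]
  [∀ g : ↥(arch (↥(maximalRealSubfield L)) L (IsCMField.complexConj L) N (diagonal α)),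
    BorelSpace (↥(arch (↥(maximalRealSubfield L)) L (IsCMField.complexConj L) N (diagonal α)) ⧸
      Subgroup.centralizer ({g} : Set ↥(arch (↥(maximalRealSubfield L)) L (IsCMField.complexConj L) N (diagonal α))))]
  [NumberField L] [IsCMField L] in
/-- Precomposition with a family of permutations is continuous on `(S¹)^{W×N}` and preserves the regular set. [cite: BrockerTomDieck1985, Ch. IV (3.1)] -/
theorem continuous_comp_perm (ρ : {w : InfinitePlace L // IsComplex w} → Perm (Fin N)) :
    Continuous fun z : {w : InfinitePlace L // IsComplex w} → Fin N → Circle => fun w => z w ∘ ρ w :=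
  continuous_pi fun w => continuous_pi fun i => (continuous_apply (ρ w i)).comp (continuous_apply w)

open scoped Classical in
/-- **(j3) CONTINUITY OF THE STABLE ARCHIMEDEAN ORBITAL INTEGRAL ON THE REGULAR TORUS, from the continuity of the torus function**: if `z ↦ ∫_{G′_∞} a(g · t(z) · g⁻¹) dν` is
continuous on `T_reg = {z ∣ ∀ w, z_w injective}` (the (V2)-glob statement of ROAD-Sd, F0P3a-p06 — per place ★-to-be `continuousOn_integral_comp_conj_circleDiagonal`; taken here as the
hypothesis `hF`), then so is `z ↦ Φ^st_∞(t(z), a)` — by (j2), a finite average of the torus function at the permuted (still regular) points. [cite: Rogawski1990, §8.2 Prop. 8.2.1 p. 118]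
[cite: Shelstad1979, §4] -/
theorem continuousOn_archStableOrbitalIntegral_archDiagTorus_of_continuousOn (hα : ∀ i, α i ≠ 0)
    (hherm : ∀ i, (IsCMField.complexConj L (α i) : L) = α i)
    {ν : Measure (arch (↥(maximalRealSubfield L)) L (IsCMField.complexConj L) N (diagonal α))} [ν.IsHaarMeasure] [ν.IsMulRightInvariant]
    {m : OrbitalMeasureFamily ↥(arch (↥(maximalRealSubfield L)) L (IsCMField.complexConj L) N (diagonal α))}
    (hm : m.IsCanonical (fun γ => IsRegularElt (γ.val : GL (Fin N) (mixedSpace L))) ν)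
    (a : arch (↥(maximalRealSubfield L)) L (IsCMField.complexConj L) N (diagonal α) → ℂ) (ha : Continuous a)
    (hF : ContinuousOn (fun z : {w : InfinitePlace L // IsComplex w} → Fin N → Circle => ∫ g, a (g * archDiagTorus L N α z * g⁻¹) ∂ν)
      {z | ∀ w, Function.Injective (z w)}) :
    ContinuousOn (fun z : {w : InfinitePlace L // IsComplex w} → Fin N → Circle => archStableOrbitalIntegral L N (diagonal α) m a (archDiagTorus L N α z))
      {z | ∀ w, Function.Injective (z w)} := by
  have heq : Set.EqOn
      (fun z : {w : InfinitePlace L // IsComplex w} → Fin N → Circle => archStableOrbitalIntegral L N (diagonal α) m a (archDiagTorus L N α z))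
      (fun z => ((∏ w : {w : InfinitePlace L // IsComplex w},
          (Finset.univ.filter fun i => 0 < (w.1.embedding (α i)).re).card.factorial *
            (N - (Finset.univ.filter fun i => 0 < (w.1.embedding (α i)).re).card).factorial : ℕ) : ℂ)⁻¹ *
        ∑ ρ : {w : InfinitePlace L // IsComplex w} → Perm (Fin N), ∫ g, a (g * archDiagTorus L N α (fun w => z w ∘ ρ w) * g⁻¹) ∂ν)
      {z | ∀ w, Function.Injective (z w)} :=
    fun z hz => archStableOrbitalIntegral_archDiagTorus_eq_inv_mul_sum_integral_conj L N α hα hherm hm hz a ha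
  refine (ContinuousOn.congr ?_ heq)
  refine continuousOn_const.mul (continuousOn_finsetSum _ fun ρ _ => ?_)
  refine hF.comp (continuous_comp_perm L N ρ).continuousOn fun z hz w => ?_
  exact (hz w).comp (ρ w).injective

end Torus

end UnitaryGroup

end Literature.NumberTheory.Automorphic

end
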